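import Summits.CriticalPhenomena.PercolationContinuityZ3.Theorems.SoloBlindGirdleOneEnded
import Literature.Probability.Percolation.InequalitiesProofs
import Literature.Probability.Percolation.CriticalContinuityProofs
import HarnessLib

/-!
# Girdles, II: the girdle criterion for `θ(p_c) = 0` on `ℤ^d`

A sufficient condition for continuity of the percolation probability at `p_c(ℤ^d)` (`d ≥ 2`,
in particular `d = 3`) whose mechanism is the *uniqueness of the infinite cluster* (through
one-endedness off a box, `SoloBlindGirdleOneEnded.lean`) rather than a one-arm or
annulus-crossing decay estimate.

Recall (`SoloBlindGirdleOneEnded.lean`): for `Λ_n = [-n, n]^d`, `girdle d n i` is the event that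
some site of the outer face `{x ∈ Λ_{n+1} : x_i = n + 1}` is joined to some site of the opposite
outer face `{x ∈ Λ_{n+1} : x_i = -(n + 1)}` by an open path none of whose steps has an endpoint
in `Λ_n`.

**Theorem** (`tendsto_real_girdle`). If `p < 1` and `θ(p) > 0` then `P_p(girdle d n i) → 1` as
`n → ∞`, for every direction `i`.

**Corollary** (`percolationContinuity_of_girdles`, `percolationContinuityZ3_of_girdles`). If for
some `c > 0` and some direction `i`, `P_{p_c}(girdle d n i) ≤ 1 - c` for infinitely many `n`, then
`θ(p_c) = 0` (`d ≥ 2`; on `ℤ³`: `PercolationContinuityZ3`).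

Proof of the theorem. (1) The `2d` face-arm events are increasing, have equal probabilities
(signed coordinate permutations of `ℤ^d` preserve `P_p`, `Λ_n` and permute the outer faces;
`real_faceArm_eq`), and their union has probability `u_n → 1` (`tendsto_real_someFaceArm`); by the
square-root trick (Grimmett 1999, (11.14); tree: `sqrt_trick_holds`) each has probability
`≥ 1 - (1 - u_n)^{1/2d} → 1`. (2) By Harris–FKG (Grimmett 1999, Thm. (2.4); tree:
`harris_fkg_holds`) both faces `±e_i` percolate off `Λ_n` with probability `→ 1`, and by
one-endedness off `Λ_n` (`ae_oneEnded_offBox`) that event is almost surely contained in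
`girdle d n i`. The corollary is the contrapositive at `p = p_c < 1` (`criticalProb_zd_lt_one`).

References: G. Grimmett, *Percolation*, 2nd ed. (Springer, 1999), Thm. (2.4), Thm. (8.1),
(11.14). Tree inputs: `relabel_mem_percolatesVia_iff`, `openClusterIn_relabel`
(`ConstrainedClusters.lean`), `bondPercolation_real_preimage_relabel_iso`
(`BondPercolationSymmetry.lean`), `zdSignedPermIso`, `signedPerm_mem_box_iff`
(`SiteConnectionTools.lean`), `harris_fkg_holds`, `sqrt_trick_holds` (`InequalitiesProofs.lean`),
`criticalProb_zd_lt_one` (`CriticalContinuityProofs.lean`).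
-/

namespace Summit.CriticalPhenomena.PercolationContinuityZ3.Theorems

open MeasureTheory ProbabilityTheory Filter Topology
open Literature.Probability.LatticeModels Literature.Probability.Percolation

variable {d : ℕ}

/-! ### Lattice symmetries: all face arms are equally likely, all girdles are equally likely -/

/-- Invariance of `P_p` under an automorphism `e` of `ℤ^d`, in preimage form. -/
theorem real_eq_of_relabel_preimage (p : unitInterval) (e : Site d ≃ Site d)
    (hadj : ∀ u v, (zdGraph d).Adj (e u) (e v) ↔ (zdGraph d).Adj u v)
    {A B : Set (BondConfig (Site d))} (hAB : BondConfig.relabel (sym2Equiv e) ⁻¹' B = A) :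
    (bondPercolation (zdGraph d) p).real A = (bondPercolation (zdGraph d) p).real B := by
  rw [← hAB]
  exact bondPercolation_real_preimage_relabel_iso (G := zdGraph d) (G' := zdGraph d)
    { toEquiv := e, map_rel_iff' := fun {a b} => hadj a b } p B

/-- Signed coordinate permutations preserve adjacency in `ℤ^d` (iff form of the tree's
`zdSignedPermIso`). -/
theorem zdGraph_adj_signedPerm_iff (π : Equiv.Perm (Fin d)) (ε : Fin d → ℤˣ) (u v : Site d) :
    (zdGraph d).Adj (Site.signedPerm π ε u) (Site.signedPerm π ε v) ↔ (zdGraph d).Adj u v :=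
  (zdSignedPermIso π ε).map_rel_iff'

/-- Signed coordinate permutations preserve the steps off `Λ_n` (they preserve `Λ_n`). -/
theorem offBox_adj_signedPerm_iff (π : Equiv.Perm (Fin d)) (ε : Fin d → ℤˣ) {n : ℕ}
    (u v : Site d) :
    (offBox d n).Adj (Site.signedPerm π ε u) (Site.signedPerm π ε v) ↔ (offBox d n).Adj u v := by
  rw [offBox_adj, offBox_adj, signedPerm_mem_box_iff, signedPerm_mem_box_iff,
    zdGraph_adj_signedPerm_iff]

/-- Transport of face arms along a symmetry of `ℤ^d` preserving `Λ_n` and carrying one outer face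
onto another. -/
theorem relabel_preimage_faceArm (e : Site d ≃ Site d) {n : ℕ}
    (hK : ∀ u v, (offBox d n).Adj (e u) (e v) ↔ (offBox d n).Adj u v) {i j : Fin d}
    {up up' : Bool} (hface : ∀ x, e x ∈ boxFace d n j up' ↔ x ∈ boxFace d n i up) :
    BondConfig.relabel (sym2Equiv e) ⁻¹' faceArm d n j up' = faceArm d n i up := by
  ext ω
  simp only [Set.mem_preimage, mem_faceArm]
  constructor
  · rintro ⟨b, hb, hperc⟩
    obtain ⟨a, rfl⟩ := e.surjective b
    exact ⟨a, (hface a).1 hb, (relabel_mem_percolatesVia_iff e hK ω a).1 hperc⟩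
  · rintro ⟨a, ha, hperc⟩
    exact ⟨e a, (hface a).2 ha, (relabel_mem_percolatesVia_iff e hK ω a).2 hperc⟩

/-- Transport of girdles along a symmetry of `ℤ^d` preserving `Λ_n` and carrying the pair of
opposite faces `±e_i` onto the pair `±e_j`. -/
theorem relabel_preimage_girdle (e : Site d ≃ Site d) {n : ℕ}
    (hK : ∀ u v, (offBox d n).Adj (e u) (e v) ↔ (offBox d n).Adj u v) {i j : Fin d}
    (ht : ∀ x, e x ∈ boxFace d n j true ↔ x ∈ boxFace d n i true)
    (hf : ∀ x, e x ∈ boxFace d n j false ↔ x ∈ boxFace d n i false) :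
    BondConfig.relabel (sym2Equiv e) ⁻¹' girdle d n j = girdle d n i := by
  ext ω
  simp only [Set.mem_preimage, mem_girdle]
  have key : ∀ a b, e b ∈ openClusterIn (offBox d n) (BondConfig.relabel (sym2Equiv e) ω) (e a) ↔
      b ∈ openClusterIn (offBox d n) ω a := by
    intro a b
    rw [openClusterIn_relabel e hK ω a, e.injective.mem_set_image]
  constructor
  · rintro ⟨a', ha', b', hb', h⟩
    obtain ⟨a, rfl⟩ := e.surjective a'
    obtain ⟨b, rfl⟩ := e.surjective b'
    exact ⟨a, (ht a).1 ha', b, (hf b).1 hb', (key a b).1 h⟩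
  · rintro ⟨a, ha, b, hb, h⟩
    exact ⟨e a, (ht a).2 ha, e b, (hf b).2 hb, (key a b).2 h⟩

/-- Reflection `x_i ↦ -x_i`. -/
def axisRefl (i : Fin d) : Site d ≃ Site d := Site.signedPerm 1 (Function.update 1 i (-1))

/-- The reflected coordinate changes sign. -/
theorem axisRefl_apply_same (i : Fin d) (x : Site d) : axisRefl i x i = -x i := by
  have : (Equiv.symm (1 : Equiv.Perm (Fin d))) i = i := rfl
  simp [axisRefl, this]

/-- Transposition of the coordinates `i` and `j`. -/
def axisSwap (i j : Fin d) : Site d ≃ Site d := Site.signedPerm (Equiv.swap i j) 1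

/-- The transposition moves the `i`-th coordinate to position `j`. -/
theorem axisSwap_apply_right (i j : Fin d) (x : Site d) : axisSwap i j x j = x i := by
  simp [axisSwap, Equiv.symm_swap, Equiv.swap_apply_right]

/-- The reflection `x_i ↦ -x_i` exchanges the two outer faces `±e_i` of `Λ_n`. -/
theorem axisRefl_mem_boxFace {n : ℕ} {i : Fin d} {up : Bool} (x : Site d) :
    axisRefl i x ∈ boxFace d n i (!up) ↔ x ∈ boxFace d n i up := by
  have hbox : axisRefl i x ∈ box d (n + 1) ↔ x ∈ box d (n + 1) := signedPerm_mem_box_iff _ _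
  simp only [boxFace, Set.mem_setOf_eq, hbox, axisRefl_apply_same]
  cases up
  · simp only [Bool.not_false, boxFaceVal_true, boxFaceVal_false]
    constructor <;> intro h <;> exact ⟨h.1, by linarith [h.2]⟩
  · simp only [Bool.not_true, boxFaceVal_true, boxFaceVal_false]
    constructor <;> intro h <;> exact ⟨h.1, by linarith [h.2]⟩

/-- The transposition of coordinates `i, j` carries the outer face `(i, up)` onto `(j, up)`. -/
theorem axisSwap_mem_boxFace {n : ℕ} {i j : Fin d} {up : Bool} (x : Site d) :
    axisSwap i j x ∈ boxFace d n j up ↔ x ∈ boxFace d n i up := by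
  have hbox : axisSwap i j x ∈ box d (n + 1) ↔ x ∈ box d (n + 1) := signedPerm_mem_box_iff _ _
  simp only [boxFace, Set.mem_setOf_eq, hbox, axisSwap_apply_right]

/-- Opposite face arms are equally likely. -/
theorem real_faceArm_not (p : unitInterval) (n : ℕ) (i : Fin d) (up : Bool) :
    (bondPercolation (zdGraph d) p).real (faceArm d n i up) =
      (bondPercolation (zdGraph d) p).real (faceArm d n i (!up)) :=
  real_eq_of_relabel_preimage p (axisRefl i) (zdGraph_adj_signedPerm_iff _ _)
    (relabel_preimage_faceArm (axisRefl i) (offBox_adj_signedPerm_iff _ _)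
      (fun x => axisRefl_mem_boxFace x))

/-- Face arms in different directions are equally likely. -/
theorem real_faceArm_swap (p : unitInterval) (n : ℕ) (i j : Fin d) (up : Bool) :
    (bondPercolation (zdGraph d) p).real (faceArm d n i up) =
      (bondPercolation (zdGraph d) p).real (faceArm d n j up) :=
  real_eq_of_relabel_preimage p (axisSwap i j) (zdGraph_adj_signedPerm_iff _ _)
    (relabel_preimage_faceArm (axisSwap i j) (offBox_adj_signedPerm_iff _ _)
      (fun x => axisSwap_mem_boxFace x))

/-- **All `2d` face arms are equally likely.** -/
theorem real_faceArm_eq (p : unitInterval) (n : ℕ) (i j : Fin d) (up up' : Bool) :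
    (bondPercolation (zdGraph d) p).real (faceArm d n i up) =
      (bondPercolation (zdGraph d) p).real (faceArm d n j up') := by
  rw [real_faceArm_swap p n i j up]
  cases up <;> cases up'
  · rfl
  · exact real_faceArm_not p n j false
  · exact real_faceArm_not p n j true
  · rfl

/-- **All `d` girdles are equally likely.** -/
theorem real_girdle_eq (p : unitInterval) (n : ℕ) (i j : Fin d) :
    (bondPercolation (zdGraph d) p).real (girdle d n i) =
      (bondPercolation (zdGraph d) p).real (girdle d n j) :=
  real_eq_of_relabel_preimage p (axisSwap i j) (zdGraph_adj_signedPerm_iff _ _)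
    (relabel_preimage_girdle (axisSwap i j) (offBox_adj_signedPerm_iff _ _)
      (fun x => axisSwap_mem_boxFace x) (fun x => axisSwap_mem_boxFace x))

/-! ### The girdle theorem and the girdle criterion -/

/-- **Girdles are asymptotically almost sure in the percolating phase.** If `p < 1` and
`θ(p) > 0` on `ℤ^d` (`d ≥ 1`), then for every direction `i`,
`P_p(girdle d n i) → 1` as `n → ∞`. -/
theorem tendsto_real_girdle (hd : 0 < d) (p : unitInterval) (hp1 : (p : ℝ) < 1)
    (hθ : 0 < theta (zdGraph d) (0 : Site d) p) (i : Fin d) :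
    Tendsto (fun n => (bondPercolation (zdGraph d) p).real (girdle d n i)) atTop (𝓝 1) := by
  set μ := bondPercolation (zdGraph d) p with hμ
  haveI : Nonempty (Fin d × Bool) := ⟨(⟨0, hd⟩, true)⟩
  have hr0 : 0 < ((Fintype.card (Fin d × Bool) : ℝ))⁻¹ := by
    have := Fintype.card_pos (α := Fin d × Bool)
    positivity
  -- the union of the face arms has probability `u_n → 1`
  have hu := tendsto_real_someFaceArm (d := d) p hθ
  -- square-root trick + symmetry: every face arm has probability `→ 1`
  have hm : ∀ n, 1 - (1 - μ.real (someFaceArm d n)) ^ ((Fintype.card (Fin d × Bool) : ℝ))⁻¹ ≤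
      μ.real (faceArm d n i true) := by
    intro n
    obtain ⟨k, hk⟩ := sqrt_trick_holds (zdGraph d) p (fun k : Fin d × Bool => faceArm d n k.1 k.2)
      (fun k => isUpperSet_faceArm n k.1 k.2) (fun k => measurableSet_faceArm n k.1 k.2)
    rw [real_faceArm_eq p n i k.1 true k.2]
    exact hk
  have hv : Tendsto (fun n => 1 - (1 - μ.real (someFaceArm d n)) ^
      ((Fintype.card (Fin d × Bool) : ℝ))⁻¹) atTop (𝓝 1) := by
    have h1 : Tendsto (fun n => 1 - μ.real (someFaceArm d n)) atTop (𝓝 0) := by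
      simpa using (tendsto_const_nhds (x := (1 : ℝ))).sub hu
    have h2 : Tendsto (fun n => (1 - μ.real (someFaceArm d n)) ^
        ((Fintype.card (Fin d × Bool) : ℝ))⁻¹) atTop (𝓝 0) := by
      have := h1.rpow_const (Or.inr hr0.le)
      rwa [Real.zero_rpow hr0.ne'] at this
    simpa using (tendsto_const_nhds (x := (1 : ℝ))).sub h2
  have hmt : Tendsto (fun n => μ.real (faceArm d n i true)) atTop (𝓝 1) :=
    tendsto_of_tendsto_of_tendsto_of_le_of_le hv tendsto_const_nhds hm (fun n => measureReal_le_one)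
  have hmf : Tendsto (fun n => μ.real (faceArm d n i false)) atTop (𝓝 1) :=
    hmt.congr fun n => real_faceArm_eq p n i i true false
  -- Harris–FKG and one-endedness: both faces `±e_i` percolate off `Λ_n` ⊆ girdle (a.s.)
  have hg : ∀ n, μ.real (faceArm d n i true) * μ.real (faceArm d n i false) ≤
      μ.real (girdle d n i) := by
    intro n
    refine (harris_fkg_holds (zdGraph d) p (isUpperSet_faceArm n i true)
      (isUpperSet_faceArm n i false) (measurableSet_faceArm n i true)
      (measurableSet_faceArm n i false)).trans ?_
    refine ENNReal.toReal_mono (measure_ne_top μ _) (measure_mono_ae ?_)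
    filter_upwards [ae_oneEnded_offBox (d := d) n p hp1] with ω hω
    rintro ⟨hA, hB⟩
    obtain ⟨a, ha, hpa⟩ := mem_faceArm.1 hA
    obtain ⟨b, hb, hpb⟩ := mem_faceArm.1 hB
    exact mem_girdle.2 ⟨a, ha, b, hb, hω a b hpa hpb⟩
  have hprod : Tendsto (fun n => μ.real (faceArm d n i true) * μ.real (faceArm d n i false))
      atTop (𝓝 1) := by
    simpa using hmt.mul hmf
  exact tendsto_of_tendsto_of_tendsto_of_le_of_le hprod tendsto_const_nhds hg
    (fun n => measureReal_le_one)

/-- **The girdle criterion for `θ(p_c) = 0` on `ℤ^d`, `d ≥ 2`.** If for some direction `i` and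
some `c > 0` the girdle event has `P_{p_c}`-probability at most `1 - c` for infinitely many `n`,
then `θ(p_c) = 0`. -/
theorem percolationContinuity_of_girdles (hd : 2 ≤ d) (i : Fin d) {c : ℝ} (hc : 0 < c)
    (h : ∃ᶠ n in atTop,
      (bondPercolation (zdGraph d) (criticalProbI d)).real (girdle d n i) ≤ 1 - c) :
    PercolationContinuity d := by
  show theta (zdGraph d) 0 (criticalProbI d) = 0
  by_contra hne
  have hθ : 0 < theta (zdGraph d) (0 : Site d) (criticalProbI d) :=
    lt_of_le_of_ne (by unfold theta; exact measureReal_nonneg) (Ne.symm hne)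
  have hp1 : ((criticalProbI d : unitInterval) : ℝ) < 1 := by
    rw [coe_criticalProbI]
    exact criticalProb_zd_lt_one hd
  have ht := tendsto_real_girdle (lt_of_lt_of_le (by norm_num) hd) (criticalProbI d) hp1 hθ i
  have hev : ∀ᶠ n in atTop,
      1 - c < (bondPercolation (zdGraph d) (criticalProbI d)).real (girdle d n i) :=
    ht.eventually (lt_mem_nhds (by linarith))
  obtain ⟨n, hn1, hn2⟩ := (h.and_eventually hev).exists
  linarith

/-- **The girdle criterion on `ℤ³`.** If for some direction `i` and some `c > 0`,
`P_{p_c(ℤ³)}(`the faces `x_i = n + 1` and `x_i = -(n + 1)` of `Λ_{n+1}` are joined by an open path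
with no endpoint in `Λ_n`) ≤ 1 - c` for infinitely many `n`, then `θ(p_c) = 0` on `ℤ³`. -/
theorem percolationContinuityZ3_of_girdles (i : Fin 3) {c : ℝ} (hc : 0 < c)
    (h : ∃ᶠ n in atTop,
      (bondPercolation (zdGraph 3) (criticalProbI 3)).real (girdle 3 n i) ≤ 1 - c) :
    PercolationContinuityZ3 :=
  percolationContinuity_of_girdles (by norm_num) i hc h

end Summit.CriticalPhenomena.PercolationContinuityZ3.Theorems
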